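import Literature.Geometry.Riemannian.LinearHeatWeakExistence
import Literature.Geometry.Riemannian.LinearHeatVeryWeakClassical
import Literature.Geometry.Lorentzian.GreenIdentityCompactSupport
import Literature.Geometry.Riemannian.ShrinkerEntropyProofs
import HarnessLib

/-!
# The energy inequality of the static linear heat operator for spatially compactly supported test
# functions on a complete manifold (crux `EntropyRung.NoncompactShrinkerGap`, stmt-SmoothPoincare4-10868,
# line `collapsed-ends-usc`, v13)

Auxiliary file of the registered helper `helper_veryWeakHeat_noncompact` (Lions' very weak existence for
`∂ₛu − Δ_g u + Qu = G` on a NON-compact Riemannian manifold `(M, g)` modelled on `ℝⁿ`). It transplants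
the compactness-dependent steps of `LinearHeatWeakExistence.lean` (closed `M`, time-dependent family,
density ratio `ρ`) to the static metric `g` (`ρ ≡ 1`) on a non-compact `M`, for test functions `φ`
smooth on `M × ℝ` which VANISH OFF `K × ℝ` for a compact `K ⊆ M`:

* `integrableOn_strip_of_continuous_of_vanish` — a continuous `F` vanishing off `K × ℝ` is integrable
  on the strip `M × (a, b)` for `V_g ⊗ ds` (`V_g` is finite on compact sets,
  `isFiniteMeasureOnCompacts_riemVolume`; no finiteness of `V_g(M)`);
* `integral_mul_laplaceBeltrami_self_nonpos_cs` — `∫ u Δ_g u dV_g = −∫ |∇u|² ≤ 0` for `u ∈ C²_c(M)`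
  (Green's identity for compactly supported functions on a non-compact manifold,
  `GreenIdentityCompactSupport.lean`);
* `heatAdjoint_static_add`, `heatAdjoint_static_smul` — pointwise linearity of
  `𝒜φ = −∂ₛφ − Δ_g φ(·, s) + Qφ`;
* **`energy_le_integral_mul_heatAdjoint_static`** (registered as `helper_energyIneq_static`) — the
  energy inequality (Trèves 1975, (41.7)) with
  `ρ ≡ 1`: if `Q ≥ 1` on `M × [a, b]`, then for `φ` smooth, vanishing off `K × ℝ` and for `s ≥ b`,
  `∫_{M×(a,b)} φ² ≤ ∫_{M×(a,b)} φ 𝒜φ`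
  (`∫ φ(−∂ₛφ) ds = ½φ(a)² ≥ 0`, `−∫ φΔφ dV_g = ∫ |∇φ|² ≥ 0`, `Q ≥ 1`; Fubini for the σ-finite `V_g`).

Everything is proved; no definitions.

References: F. Trèves, *Basic Linear Partial Differential Equations* (1975), §41, (41.7) and Lemma 41.2;
J. M. Lee, *Introduction to Riemannian Manifolds*, 2nd ed. (2018), Problem 2-23 (a).
-/

noncomputable section

set_option linter.dupNamespace false

open scoped Manifold ContDiff ENNReal NNReal Topology InnerProductSpace
open MeasureTheory Set Filter
open Literature.Geometry.Lorentzian Literature.Geometry.Riemannian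

namespace Summit.SmoothPoincare4.SmoothPoincare4.Theorems.NoncompactShrinkerGapHeat

section VeryWeakStaticAux

variable {n : ℕ} {M : Type*} [TopologicalSpace M] [T2Space M] [SecondCountableTopology M]
  [ChartedSpace (EuclideanSpace ℝ (Fin n)) M] [IsManifold (𝓡 n) ∞ M] [T3Space M] [MeasurableSpace M]
  [BorelSpace M]
  {g : PseudoRiemannianMetric (𝓡 n) ∞ (EuclideanSpace ℝ (Fin n)) (TangentSpace (𝓡 n) : M → Type _)}

omit [T2Space M] in
/-- A continuous function on `M × ℝ` vanishing off `K × ℝ`, `K ⊆ M` compact, is integrable on every strip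
`M × (a, b)` for `V_g ⊗ ds` (it is integrable on the compact `K × [a, b]`, `V_g` being finite on compact
sets, and vanishes on the rest of the strip). [folklore] -/
theorem integrableOn_strip_of_continuous_of_vanish (hg : g.IsRiemannian) {K : Set M} (hK : IsCompact K)
    {F : M × ℝ → ℝ} (hF : Continuous F) (hF0 : ∀ p : M × ℝ, p.1 ∉ K → F p = 0) (a b : ℝ) :
    IntegrableOn F (univ ×ˢ Ioo a b) (g.riemVolume.prod (volume : Measure ℝ)) := by
  haveI : IsFiniteMeasureOnCompacts g.riemVolume :=
    CarrilloNi2009_shrinkerLSI.isFiniteMeasureOnCompacts_riemVolume hg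
  have h1 : IntegrableOn F (K ×ˢ Icc a b) (g.riemVolume.prod (volume : Measure ℝ)) :=
    hF.continuousOn.integrableOn_compact (hK.prod isCompact_Icc)
  refine h1.of_forall_sdiff_eq_zero (MeasurableSet.univ.prod measurableSet_Ioo) ?_
  rintro p ⟨hp, hp'⟩
  exact hF0 p fun h ↦ hp' ⟨h, Ioo_subset_Icc_self hp.2⟩

/-- **`∫ u Δ_g u dV_g ≤ 0` for `u ∈ C²_c(M)`** on a (non-compact) Riemannian manifold modelled on `ℝⁿ`:
Green's identity for a compactly supported factor
(`integral_mul_dalembertian_eq_neg_integral_innerDual_of_hasCompactSupport`) gives `= −∫ g⁻¹(du, du) ≤ 0`.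
[cite: Lee2018, Problem 2-23 (a)] -/
theorem integral_mul_laplaceBeltrami_self_nonpos_cs (hg : g.IsRiemannian) {u : M → ℝ}
    (hu : ContMDiff (𝓡 n) 𝓘(ℝ, ℝ) 2 u) (huc : HasCompactSupport u) :
    ∫ x, u x * g.laplaceBeltrami u x ∂g.riemVolume ≤ 0 := by
  haveI : LocallyCompactSpace M := ChartedSpace.locallyCompactSpace (EuclideanSpace ℝ (Fin n)) M
  haveI := g.hasLeviCivita
  haveI := (PseudoRiemannianMetric.ofRiemannian (g.toContMDiffRiemannianMetric hg)).hasLeviCivita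
  have h1le : (1 : ℕ∞ω) ≤ (2 : ℕ∞ω) := by norm_cast
  have h1 := integral_mul_dalembertian_eq_neg_integral_innerDual_of_hasCompactSupport
    (g.toContMDiffRiemannianMetric hg) (hu.of_le h1le) huc hu
  simp only [PseudoRiemannianMetric.laplaceBeltrami_eq_dalembertian]
  rw [PseudoRiemannianMetric.riemVolume_eq hg]
  refine (le_of_eq h1).trans (neg_nonpos.2 (integral_nonneg fun x ↦ ?_))
  exact innerDual_self_nonneg (g.toContMDiffRiemannianMetric hg) x (mvfderiv (𝓡 n) u x).toLinearMap

omit [T2Space M] [SecondCountableTopology M] [T3Space M] [MeasurableSpace M] [BorelSpace M] in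
/-- The static adjoint expression `𝒜φ = −∂ₛφ − Δ_g φ(·, s) + Qφ` is additive in `φ`. [folklore] -/
theorem heatAdjoint_static_add (Q : ℝ → M → ℝ) {φ ψ : M × ℝ → ℝ}
    (hφ : ContMDiff ((𝓡 n).prod 𝓘(ℝ, ℝ)) 𝓘(ℝ, ℝ) ∞ φ) (hψ : ContMDiff ((𝓡 n).prod 𝓘(ℝ, ℝ)) 𝓘(ℝ, ℝ) ∞ ψ)
    (p : M × ℝ) :
    (-(deriv (fun s ↦ φ (p.1, s) + ψ (p.1, s)) p.2) -
        g.laplaceBeltrami (fun x ↦ φ (x, p.2) + ψ (x, p.2)) p.1 + Q p.2 p.1 * (φ p + ψ p)) =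
      (-(deriv (fun s ↦ φ (p.1, s)) p.2) - g.laplaceBeltrami (fun x ↦ φ (x, p.2)) p.1 +
        Q p.2 p.1 * φ p) +
      (-(deriv (fun s ↦ ψ (p.1, s)) p.2) - g.laplaceBeltrami (fun x ↦ ψ (x, p.2)) p.1 +
        Q p.2 p.1 * ψ p) := by
  have hd1 := hasDerivAt_time hφ p.1 p.2
  have hd2 := hasDerivAt_time hψ p.1 p.2
  rw [deriv_fun_add hd1.differentiableAt hd2.differentiableAt, laplaceBeltrami_slice_add g hφ hψ p.2 p.1]
  ring

omit [T2Space M] [SecondCountableTopology M] [T3Space M] [MeasurableSpace M] [BorelSpace M] in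
/-- The static adjoint expression `𝒜φ = −∂ₛφ − Δ_g φ(·, s) + Qφ` is homogeneous in `φ`. [folklore] -/
theorem heatAdjoint_static_smul (Q : ℝ → M → ℝ) {φ : M × ℝ → ℝ}
    (hφ : ContMDiff ((𝓡 n).prod 𝓘(ℝ, ℝ)) 𝓘(ℝ, ℝ) ∞ φ) (c : ℝ) (p : M × ℝ) :
    (-(deriv (fun s ↦ c * φ (p.1, s)) p.2) - g.laplaceBeltrami (fun x ↦ c * φ (x, p.2)) p.1 +
        Q p.2 p.1 * (c * φ p)) =
      c * (-(deriv (fun s ↦ φ (p.1, s)) p.2) - g.laplaceBeltrami (fun x ↦ φ (x, p.2)) p.1 +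
        Q p.2 p.1 * φ p) := by
  have hd1 := hasDerivAt_time hφ p.1 p.2
  rw [(hd1.const_mul c).deriv, laplaceBeltrami_slice_smul g hφ c p.2 p.1]
  ring

/-- **The energy inequality for the static heat operator, spatially compactly supported test functions**
(Trèves 1975, (41.7), with `ρ ≡ 1`): on a (non-compact) Riemannian manifold `(M, g)` modelled on `ℝⁿ`, if
`Q ≥ 1` on `M × [a, b]`, `a < b`, then for every smooth `φ` on `M × ℝ` vanishing off `K × ℝ` (`K`
compact) and for `s ≥ b`,
`∫_{M×(a,b)} φ² d(V_g ⊗ ds) ≤ ∫_{M×(a,b)} φ (−∂ₛφ − Δ_g φ(·, s) + Qφ) d(V_g ⊗ ds)`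
(`∫ₐᵇ φ(−∂ₛφ) ds = ½φ(·, a)² ≥ 0` pointwise, `−∫ φΔ_gφ dV_g ≥ 0` by Green's identity with compact support at
each time, and `Q ≥ 1`). [cite: Treves1975, §41, (41.7) and Lemma 41.2] -/
theorem energy_le_integral_mul_heatAdjoint_static (hg : g.IsRiemannian) {Q : ℝ → M → ℝ}
    (hQ : ContMDiff ((𝓡 n).prod 𝓘(ℝ, ℝ)) 𝓘(ℝ, ℝ) ∞ fun p : M × ℝ ↦ Q p.2 p.1) {a b : ℝ} (hab : a < b)
    (hQ1 : ∀ (x : M) (s : ℝ), s ∈ Icc a b → 1 ≤ Q s x) {K : Set M} (hK : IsCompact K)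
    {φ : M × ℝ → ℝ} (hφ : ContMDiff ((𝓡 n).prod 𝓘(ℝ, ℝ)) 𝓘(ℝ, ℝ) ∞ φ)
    (hφK : ∀ p : M × ℝ, p.1 ∉ K → φ p = 0) (hφb : ∀ (x : M) (s : ℝ), b ≤ s → φ (x, s) = 0) :
    ∫ p in univ ×ˢ Ioo a b, φ p ^ 2 ∂g.riemVolume.prod (volume : Measure ℝ) ≤
      ∫ p in univ ×ˢ Ioo a b, φ p * (-(deriv (fun s ↦ φ (p.1, s)) p.2) -
        g.laplaceBeltrami (fun x ↦ φ (x, p.2)) p.1 + Q p.2 p.1 * φ p)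
        ∂g.riemVolume.prod (volume : Measure ℝ) := by
  haveI : LocallyCompactSpace M := ChartedSpace.locallyCompactSpace (EuclideanSpace ℝ (Fin n)) M
  set μ₀ : Measure M := g.riemVolume with hμ₀
  haveI : IsFiniteMeasureOnCompacts μ₀ := CarrilloNi2009_shrinkerLSI.isFiniteMeasureOnCompacts_riemVolume hg
  have hfam : IsContMDiffFamilyOn ∞ (fun _ : ℝ ↦ g) univ := isContMDiffFamilyOn_const g univ
  set φt : M × ℝ → ℝ := fun p ↦ deriv (fun s ↦ φ (p.1, s)) p.2 with hφt
  set Δφ : M × ℝ → ℝ := fun p ↦ g.laplaceBeltrami (fun x ↦ φ (x, p.2)) p.1 with hΔφ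
  have hφts : ContMDiff ((𝓡 n).prod 𝓘(ℝ, ℝ)) 𝓘(ℝ, ℝ) ∞ φt := contMDiff_deriv_time hφ
  have hΔφs : ContMDiff ((𝓡 n).prod 𝓘(ℝ, ℝ)) 𝓘(ℝ, ℝ) ∞ Δφ := contMDiff_laplaceBeltrami_family hfam hφ
  -- the restricted product measure is a product
  set νt : Measure ℝ := (volume : Measure ℝ).restrict (Ioo a b) with hνt
  haveI : IsFiniteMeasure νt := ⟨by
    rw [hνt, Measure.restrict_apply_univ]; exact measure_Ioo_lt_top⟩
  have hπ : (μ₀.prod (volume : Measure ℝ)).restrict (univ ×ˢ Ioo a b) = μ₀.prod νt := by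
    rw [hνt, ← Measure.prod_restrict, Measure.restrict_univ]
  have hint : ∀ {F : M × ℝ → ℝ}, Continuous F → (∀ p : M × ℝ, p.1 ∉ K → F p = 0) →
      Integrable F (μ₀.prod νt) := fun hF hF0 ↦ by
    rw [← hπ]; exact integrableOn_strip_of_continuous_of_vanish hg hK hF hF0 a b
  -- decomposition of the integrand
  have hdec : ∀ p, φ p * (-(deriv (fun s ↦ φ (p.1, s)) p.2) -
      g.laplaceBeltrami (fun x ↦ φ (x, p.2)) p.1 + Q p.2 p.1 * φ p) =
      -(φ p * φt p) + -(φ p * Δφ p) + Q p.2 p.1 * φ p ^ 2 := by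
    intro p; simp only [hφt, hΔφ]; ring
  rw [hπ]
  simp_rw [hdec]
  have hi1 : Integrable (fun p ↦ -(φ p * φt p)) (μ₀.prod νt) :=
    hint (hφ.continuous.mul hφts.continuous).neg fun p hp ↦ by rw [hφK p hp, zero_mul, neg_zero]
  have hi2 : Integrable (fun p ↦ -(φ p * Δφ p)) (μ₀.prod νt) :=
    hint (hφ.continuous.mul hΔφs.continuous).neg fun p hp ↦ by rw [hφK p hp, zero_mul, neg_zero]
  have hi3 : Integrable (fun p ↦ Q p.2 p.1 * φ p ^ 2) (μ₀.prod νt) :=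
    hint (hQ.continuous.mul (hφ.continuous.pow 2)) fun p hp ↦ by rw [hφK p hp]; ring
  have hi0 : Integrable (fun p ↦ φ p ^ 2) (μ₀.prod νt) :=
    hint (hφ.continuous.pow 2) fun p hp ↦ by rw [hφK p hp]; ring
  -- (1) the time term is nonnegative: `∫ₐᵇ −φ ∂ₛφ ds = ½ φ(x, a)²`
  have h1 : 0 ≤ ∫ p, -(φ p * φt p) ∂μ₀.prod νt := by
    rw [integral_prod _ hi1]
    refine integral_nonneg fun x ↦ ?_
    dsimp only
    have hφx : ∀ s, HasDerivAt (fun s' ↦ φ (x, s')) (φt (x, s)) s := fun s ↦ hasDerivAt_time hφ x s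
    have c2 : Continuous fun s ↦ φ (x, s) := (contDiff_slice_time hφ x).continuous
    have c4 : Continuous fun s ↦ φt (x, s) := (contDiff_slice_time hφts x).continuous
    have hE : ∀ s, HasDerivAt (fun s' ↦ φ (x, s') ^ 2) (2 * φ (x, s) * φt (x, s)) s := by
      intro s
      have hsq : (fun s' ↦ φ (x, s') ^ 2) = fun s' ↦ φ (x, s') * φ (x, s') := funext fun s' ↦ by ring
      rw [hsq]
      exact ((hφx s).fun_mul (hφx s)).congr_deriv (by ring)
    have hcE : Continuous fun s ↦ 2 * φ (x, s) * φt (x, s) := (continuous_const.mul c2).mul c4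
    have hFTC : ∫ s in a..b, 2 * φ (x, s) * φt (x, s) = 0 - φ (x, a) ^ 2 := by
      rw [intervalIntegral.integral_eq_sub_of_hasDerivAt (fun s _ ↦ hE s) (hcE.intervalIntegrable a b),
        hφb x b le_rfl]
      ring
    have hI : ∀ (f : ℝ → ℝ), ∫ s, f s ∂νt = ∫ s in a..b, f s := fun f ↦ by
      rw [hνt, intervalIntegral.integral_of_le hab.le, integral_Ioc_eq_integral_Ioo]
    rw [hI]
    have heq : ∫ s in a..b, -(φ (x, s) * φt (x, s)) = (1 / 2) * φ (x, a) ^ 2 := by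
      have : ∀ s, -(φ (x, s) * φt (x, s)) = -(1 / 2) * (2 * φ (x, s) * φt (x, s)) := fun s ↦ by ring
      simp_rw [this]
      rw [intervalIntegral.integral_const_mul, hFTC]
      ring
    rw [heq]
    positivity
  -- (2) the space term is nonnegative (Green with compact support at each time)
  have h2 : 0 ≤ ∫ p, -(φ p * Δφ p) ∂μ₀.prod νt := by
    rw [integral_prod_symm _ hi2]
    refine integral_nonneg fun s ↦ ?_
    change (0 : ℝ) ≤ ∫ x, -(φ (x, s) * Δφ (x, s)) ∂μ₀
    rw [MeasureTheory.integral_neg, neg_nonneg]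
    have h2' : (2 : ℕ∞ω) ≤ ((⊤ : ℕ∞) : ℕ∞ω) := WithTop.coe_le_coe.mpr le_top
    have hcs : HasCompactSupport fun x ↦ φ (x, s) :=
      HasCompactSupport.of_support_subset_isCompact hK fun x hx ↦ by
        by_contra hxK
        exact hx (hφK (x, s) hxK)
    exact integral_mul_laplaceBeltrami_self_nonpos_cs hg ((contMDiff_slice_space hφ s).of_le h2') hcs
  -- (3) assemble with `Q ≥ 1`
  have hsum : ∫ p, -(φ p * φt p) + -(φ p * Δφ p) + Q p.2 p.1 * φ p ^ 2 ∂μ₀.prod νt =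
      (∫ p, -(φ p * φt p) ∂μ₀.prod νt) + (∫ p, -(φ p * Δφ p) ∂μ₀.prod νt) +
        ∫ p, Q p.2 p.1 * φ p ^ 2 ∂μ₀.prod νt := by
    have hi12 : Integrable (fun p ↦ -(φ p * φt p) + -(φ p * Δφ p)) (μ₀.prod νt) := hi1.add hi2
    rw [integral_add hi12 hi3, integral_add hi1 hi2]
  rw [hsum]
  have hcoer' : ∫ p, φ p ^ 2 ∂μ₀.prod νt ≤ ∫ p, Q p.2 p.1 * φ p ^ 2 ∂μ₀.prod νt := by
    refine integral_mono_ae hi0 hi3 ?_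
    have hmem : ∀ᵐ p ∂μ₀.prod νt, p ∈ univ ×ˢ Ioo a b := by
      rw [← hπ]; exact ae_restrict_mem (MeasurableSet.univ.prod measurableSet_Ioo)
    filter_upwards [hmem] with p hp
    have hc := hQ1 p.1 p.2 (Ioo_subset_Icc_self hp.2)
    have hsq : 0 ≤ φ p ^ 2 := sq_nonneg _
    nlinarith
  linarith

end VeryWeakStaticAux

/-- **Registered auxiliary helper `helper_energyIneq_static`** (line `collapsed-ends-usc`): the energy
inequality `∫_{M×(a,b)} φ² ≤ ∫_{M×(a,b)} φ (−∂ₛφ − Δ_g φ(·, s) + Qφ)` of the static heat operator with `Q ≥ 1`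
on `M × [a, b]`, for smooth `φ` vanishing off `K × ℝ` (`K ⊆ M` compact) and for `s ≥ b`, on a (non-compact)
Riemannian manifold modelled on `ℝⁿ` (`energy_le_integral_mul_heatAdjoint_static`).
[cite: Treves1975, §41, (41.7) and Lemma 41.2] -/
theorem helper_energyIneq_static : ∀ (n : ℕ) (M : Type*) [TopologicalSpace M] [T2Space M] [SecondCountableTopology M] [ChartedSpace (EuclideanSpace ℝ (Fin n)) M] [IsManifold (𝓡 n) ∞ M] [T3Space M] [MeasurableSpace M] [BorelSpace M] (g : PseudoRiemannianMetric (𝓡 n) ∞ (EuclideanSpace ℝ (Fin n)) (TangentSpace (𝓡 n) : M → Type _)), g.IsRiemannian → ∀ (Q : ℝ → M → ℝ), ContMDiff ((𝓡 n).prod 𝓘(ℝ, ℝ)) 𝓘(ℝ, ℝ) ∞ (fun p : M × ℝ ↦ Q p.2 p.1) → ∀ (a b : ℝ), a < b → (∀ (x : M) (s : ℝ), s ∈ Icc a b → 1 ≤ Q s x) → ∀ (K : Set M) (φ : M × ℝ → ℝ), IsCompact K → ContMDiff ((𝓡 n).prod 𝓘(ℝ, ℝ)) 𝓘(ℝ,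 ℝ) ∞ φ → (∀ p : M × ℝ, p.1 ∉ K → φ p = 0) → (∀ (x : M) (s : ℝ), b ≤ s → φ (x, s) = 0) → ∫ p in univ ×ˢ Ioo a b, φ p ^ 2 ∂(g.riemVolume.prod (volume : Measure ℝ)) ≤ ∫ p in univ ×ˢ Ioo a b, φ p * (-(deriv (fun s ↦ φ (p.1, s)) p.2) - g.laplaceBeltrami (fun x ↦ φ (x, p.2)) p.1 + Q p.2 p.1 * φ p) ∂(g.riemVolume.prod (volume : Measure ℝ)) := by
  intro n M _ _ _ _ _ _ _ _ g hg Q hQ a b hab hQ1 K φ hK hφ hφK hφb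
  exact energy_le_integral_mul_heatAdjoint_static hg hQ hab hQ1 hK hφ hφK hφb

end Summit.SmoothPoincare4.SmoothPoincare4.Theorems.NoncompactShrinkerGapHeat

end
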